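import Mathlib
import Summits.NavierStokesRegularity.NavierStokesRegularity.Theorems.TaoLadderRungThreeGappedFrontRobustTailStep
import HarnessLib

/-!
# `BarrierSoundness` (route `BarrierStepRungThree`), tools II-b: the UPPER tail of a pseudo-flow —
  square-root tail-sum cap and the one-directional induction up the high shells

Helper lemmas for item stmt-NavierStokesRegularity-23421 (`BarrierSoundness`, repaired form K2′): Tao-type
MODEL lattice pseudo-flows (`TaoCascade.PseudoFlowOn`) with a CANCELLING table, using the tree's bond
flux `botSum` (`TaoCascadeNoLow`) and the tail energy cap / Bihari lemma of `Theorems.GappedFrontRobust`: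

* `pseudoFlowOn_tailsum_sqrt_le` — square-root (Bihari) form of the tail energy cap for ALL partial
  sums above a bond: `√(∑_{k<L}∑_i F_{i,K+k}(s)) ≤ √E₀ + (√2/2)(1+ε₀)^{5(K-1)/2}(∑|α_{·,(0,0,1)}|) q² s`
  when `|S_{·,K-1}| ≤ q` on `[0, τ]`;
* `pseudoFlowOn_upper_tail_induction` — the ONE-DIRECTIONAL INDUCTION: given start tail sums
  `≤ r_k²/2` above every `k ≥ K`, a profile with `r_k + c ρ_k ≤ q_k` and
  `(1+ε₀)^{5(k-1)/2}(∑|α_{·,(0,0,1)}|) q_{k-1}² ≤ ρ_k`, and the base bound `|S_{·,K-1}| ≤ q_{K-1}` on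
  `[0, τ]` with `τ ≤ c`, every tail sum above every `k ≥ K` stays `≤ q_k²/2` on `[0, τ]` — by induction
  on `k`, with no bootstrap over the infinitely many shells (which is exactly what the per-shell,
  two-sided TAIL RATE format of the original item could not provide).

HONEST FRAMING: nothing here is a statement about the Navier–Stokes equations and nothing is asserted
about any table; the route's rung leaf (`TaoLadderRungThree.Target`, TL-M3) is not the summit Statement.
-/

noncomputable section

-- the sub-problem namespace `Summit.NavierStokesRegularity.NavierStokesRegularity` repeats the summit name by design (D-0017)
set_option linter.dupNamespace false

namespace Summit.NavierStokesRegularity.NavierStokesRegularity.Theorems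

namespace BarrierSoundness

open Set MeasureTheory intervalIntegral Filter Topology
open Literature.Analysis.FluidPDE Literature.Analysis.FluidPDE.TaoCascade GappedFrontRobust

variable {m : ℕ} {τ ε₀ : ℝ} {α : Fin m → Fin m → Fin m → ℤ × ℤ × ℤ → ℝ} {κ₁ κ₂ : ℝ}
  {S₀ F₀ B₀ : Fin m → ℤ → ℝ} {S F : Fin m → ℤ → ℝ → ℝ}

/-! ### The one-directional induction up the high shells -/

/-- **Square-root form of the tail energy cap for all partial sums.** Along a pseudo-flow on `[0, τ]`
(`τ > 0`, `ε₀ > 0`, cancelling table), if all partial sums of the START energies above the bond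
`K-1 | K` are `≤ E₀` (`E₀ ≥ 0`) and the amplitudes of shell `K-1` obey `|S_{i,K-1}(u)| ≤ q` on `[0, τ]`,
then every partial sum at time `s` satisfies
`√(∑_{k<L}∑_i F_{i,K+k}(s)) ≤ √E₀ + (√2/2)(1+ε₀)^{5(K-1)/2}(∑|α_{·,(0,0,1)}|) q² s` (the bond flux has
two factors at `K-1` and one at `K`, the latter bounded by the square root of the partial sum itself;
Bihari). [cite: Tao2016AveragedNS, §4 Lemma 4.1 (4.5), (4.9)–(4.10) with (4.3)] -/
theorem pseudoFlowOn_tailsum_sqrt_le (h : PseudoFlowOn τ ε₀ α κ₁ κ₂ S₀ F₀ B₀ S F) (hτ : 0 < τ)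
    (hε : 0 < ε₀) (hα : IsCancellingCoeff α) (K : ℤ) {E₀ q : ℝ} (hE₀0 : 0 ≤ E₀)
    (hE₀ : ∀ L : ℕ, ∑ k ∈ Finset.range L, ∑ i, F₀ i (K + k) ≤ E₀)
    (hq : ∀ u ∈ Icc 0 τ, ∀ i, |S i (K - 1) u| ≤ q) {L : ℕ} (hL : 1 ≤ L) {s : ℝ} (hs : s ∈ Icc 0 τ) :
    Real.sqrt (∑ k ∈ Finset.range L, ∑ i, F i (K + k) s) ≤ Real.sqrt E₀ +
      Real.sqrt 2 / 2 * (1 + ε₀) ^ ((5 : ℝ) * (K - 1 : ℤ) / 2) *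
        (∑ i₁, ∑ i₂, ∑ i₃, |α i₁ i₂ i₃ (0, 0, 1)|) * q ^ 2 * s := by
  have hq1 : 0 < 1 + ε₀ := by linarith
  set Λ : ℝ := (1 + ε₀) ^ ((5 : ℝ) * (K - 1 : ℤ) / 2) with hΛ
  have hΛ0 : 0 ≤ Λ := (Real.rpow_pos_of_pos hq1 _).le
  set A : ℝ := ∑ i₁ : Fin m, ∑ i₂ : Fin m, ∑ i₃ : Fin m, |α i₁ i₂ i₃ (0, 0, 1)| with hA
  have hA0 : 0 ≤ A := Finset.sum_nonneg fun _ _ => Finset.sum_nonneg fun _ _ =>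
    Finset.sum_nonneg fun _ _ => abs_nonneg _
  have hS : ∀ i n, ContinuousOn (S i n) (Icc 0 τ) := fun i n => (h.contDiffOn_S i n).continuousOn
  have hFc : ∀ i n, ContinuousOn (F i n) (Icc 0 τ) := fun i n => (h.contDiffOn_F i n).continuousOn
  -- the partial sum y and the constant weight g
  set y : ℝ → ℝ := fun u => ∑ k ∈ Finset.range L, ∑ i, F i (K + k) u with hy
  set g : ℝ → ℝ := fun _ => Real.sqrt 2 * Λ * A * q ^ 2 with hg
  have hy_cont : ContinuousOn y (Icc 0 τ) :=
    continuousOn_finsetSum _ fun k _ => continuousOn_finsetSum _ fun i _ => hFc i (K + k)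
  have hg_cont : ContinuousOn g (Icc 0 τ) := continuousOn_const
  have hg0 : ∀ u ∈ Icc 0 τ, 0 ≤ g u := fun u _ => by positivity
  -- shell K lies in the block (L ≥ 1): its amplitudes are bounded by √(2 y)
  have hmem : 0 ∈ Finset.range L := Finset.mem_range.mpr (by omega)
  have hQ : ∀ u ∈ Icc 0 τ, ∀ i, |S i K u| ≤ Real.sqrt (2 * y u) := by
    intro u hu i
    have h1 : F i K u ≤ ∑ j, F j K u :=
      Finset.single_le_sum (f := fun j => F j K u) (fun j _ => h.nonneg_F j K u hu) (Finset.mem_univ i)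
    have h2 : ∑ j, F j K u ≤ y u := by
      have := Finset.single_le_sum (f := fun k : ℕ => ∑ j, F j (K + k) u)
        (fun k _ => Finset.sum_nonneg fun j _ => h.nonneg_F j (K + k) u hu) hmem
      simpa using this
    exact Real.abs_le_sqrt (by linarith [h.defect_lower i K u hu])
  -- the integral inequality y ≤ E₀ + ∫ g √y
  have hle : ∀ x ∈ Icc 0 τ, y x ≤ E₀ + ∫ u in (0 : ℝ)..x, g u * Real.sqrt (y u) := by
    intro x hx
    have hsub : uIcc 0 x ⊆ Icc 0 τ := by
      rw [uIcc_of_le hx.1]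
      exact Icc_subset_Icc_right hx.2
    have h1 : y x ≤ E₀ + ∫ u in (0 : ℝ)..x, botSum ε₀ α S (K - 1) u := by
      have := pseudoFlowOn_tail_energy_le h hτ hε hα K hE₀ L hx
      simpa only [hy] using this
    have hbint : IntervalIntegrable (fun u => botSum ε₀ α S (K - 1) u) volume 0 x :=
      ((continuousOn_botSum ε₀ α hS (K - 1)).mono hsub).intervalIntegrable
    have hgyint : IntervalIntegrable (fun u => g u * Real.sqrt (y u)) volume 0 x :=
      ((hg_cont.mul hy_cont.sqrt).mono hsub).intervalIntegrable
    have h2 : ∫ u in (0 : ℝ)..x, botSum ε₀ α S (K - 1) u ≤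
        ∫ u in (0 : ℝ)..x, g u * Real.sqrt (y u) := by
      refine intervalIntegral.integral_mono_on hx.1 hbint hgyint fun u hu => ?_
      have huτ : u ∈ Icc 0 τ := ⟨hu.1, hu.2.trans hx.2⟩
      have hb := abs_botSum_le_of_abs_le ε₀ hq1 α S (K - 1) u (hq u huτ) (fun i => by
        rw [sub_add_cancel]
        exact hQ u huτ i)
      have hsq : Real.sqrt (2 * y u) = Real.sqrt 2 * Real.sqrt (y u) :=
        Real.sqrt_mul (by norm_num) _
      calc botSum ε₀ α S (K - 1) u ≤ |botSum ε₀ α S (K - 1) u| := le_abs_self _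
        _ ≤ Λ * q ^ 2 * Real.sqrt (2 * y u) * A := hb
        _ = g u * Real.sqrt (y u) := by rw [hsq, hg]; ring
    linarith
  have hB := sqrt_le_sqrt_add_half_integral hy_cont hg_cont hg0 hE₀0 hle s hs
  have hconst : ∫ u in (0 : ℝ)..s, g u = Real.sqrt 2 * Λ * A * q ^ 2 * s := by
    simp only [hg, intervalIntegral.integral_const, sub_zero, smul_eq_mul]
    ring
  rw [hconst] at hB
  calc Real.sqrt (∑ k ∈ Finset.range L, ∑ i, F i (K + k) s) = Real.sqrt (y s) := rfl
    _ ≤ Real.sqrt E₀ + 1 / 2 * (Real.sqrt 2 * Λ * A * q ^ 2 * s) := hB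
    _ = Real.sqrt E₀ + Real.sqrt 2 / 2 * Λ * A * q ^ 2 * s := by ring

set_option maxHeartbeats 400000 in
/-- **ONE-DIRECTIONAL INDUCTION UP THE HIGH SHELLS.** Along a pseudo-flow on `[0, τ]` (`τ > 0`,
`ε₀ > 0`, cancelling table) with `τ ≤ c`, let `K` be a shell and `r, q, ρ : ℤ → ℝ` a profile with, for
every `k ≥ K`: `0 ≤ r_k`, `r_k + c ρ_k ≤ q_k` and the RECURSION
`(1+ε₀)^{5(k-1)/2} (∑|α_{·,(0,0,1)}|) q_{k-1}² ≤ ρ_k`. If the START tail sums satisfy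
`∑_{j<L}∑_i F₀_{i,k+j} ≤ r_k²/2` for all `k ≥ K` and all `L`, and the base shell obeys
`|S_{i,K-1}(u)| ≤ q_{K-1}` on `[0, τ]` (`q_{K-1} ≥ 0`), then for every `k ≥ K`, every `L` and every
`s ∈ [0, τ]`, `∑_{j<L}∑_i F_{i,k+j}(s) ≤ q_k²/2`. Induction on `k`: the tail sums above `k` are fed only
through the bond `k-1 | k` (`pseudoFlowOn_tailsum_sqrt_le`), and the bound at level `k` gives the
amplitude bound `|S_{·,k}| ≤ q_k` that level `k+1` consumes — no bootstrap over infinitely many shells.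
[cite: Tao2016AveragedNS, §4 Lemma 4.1 (4.5), (4.9)–(4.10) with (4.3)] -/
theorem pseudoFlowOn_upper_tail_induction (h : PseudoFlowOn τ ε₀ α κ₁ κ₂ S₀ F₀ B₀ S F) (hτ : 0 < τ)
    (hε : 0 < ε₀) (hα : IsCancellingCoeff α) {c : ℝ} (hτc : τ ≤ c) (K : ℤ) {r q ρ : ℤ → ℝ}
    (hprof : ∀ k : ℤ, K ≤ k → 0 ≤ r k ∧ r k + c * ρ k ≤ q k ∧
      (1 + ε₀) ^ ((5 : ℝ) * (k - 1 : ℤ) / 2) * (∑ i₁, ∑ i₂, ∑ i₃, |α i₁ i₂ i₃ (0, 0, 1)|) *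
        q (k - 1) ^ 2 ≤ ρ k)
    (hqK : 0 ≤ q (K - 1))
    (hstart : ∀ k : ℤ, K ≤ k → ∀ L : ℕ, ∑ j ∈ Finset.range L, ∑ i, F₀ i (k + j) ≤ r k ^ 2 / 2)
    (hbase : ∀ u ∈ Icc 0 τ, ∀ i, |S i (K - 1) u| ≤ q (K - 1)) :
    ∀ k : ℤ, K ≤ k → ∀ L : ℕ, ∀ s ∈ Icc 0 τ, ∑ j ∈ Finset.range L, ∑ i, F i (k + j) s ≤ q k ^ 2 / 2 := by
  have hq1 : 0 < 1 + ε₀ := by linarith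
  set A : ℝ := ∑ i₁ : Fin m, ∑ i₂ : Fin m, ∑ i₃ : Fin m, |α i₁ i₂ i₃ (0, 0, 1)| with hA
  have hA0 : 0 ≤ A := Finset.sum_nonneg fun _ _ => Finset.sum_nonneg fun _ _ =>
    Finset.sum_nonneg fun _ _ => abs_nonneg _
  -- one level: from the amplitude bound at k-1 (with q_{k-1} ≥ 0) to the tail-sum bound at k
  have level : ∀ k : ℤ, K ≤ k → 0 ≤ q (k - 1) → (∀ u ∈ Icc 0 τ, ∀ i, |S i (k - 1) u| ≤ q (k - 1)) →
      ∀ L : ℕ, ∀ s ∈ Icc 0 τ, ∑ j ∈ Finset.range L, ∑ i, F i (k + j) s ≤ q k ^ 2 / 2 := by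
    intro k hk hqk hamp L s hs
    obtain ⟨hr0, hrq, hrec⟩ := hprof k hk
    have hE₀0 : 0 ≤ r k ^ 2 / 2 := by positivity
    rcases Nat.eq_zero_or_pos L with hL0 | hLpos
    · subst hL0
      simp only [Finset.range_zero, Finset.sum_empty]
      positivity
    have hsq := pseudoFlowOn_tailsum_sqrt_le h hτ hε hα k hE₀0 (hstart k hk) hamp hLpos hs
    -- √(r²/2) = r/√2 and the recursion: the bound is ≤ q_k/√2
    have hs2 : (0 : ℝ) < Real.sqrt 2 := by positivity
    have hsq2 : Real.sqrt 2 * Real.sqrt 2 = 2 := Real.mul_self_sqrt (by norm_num)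
    have hr_sqrt : Real.sqrt (r k ^ 2 / 2) = r k / Real.sqrt 2 := by
      rw [Real.sqrt_div' _ (by norm_num : (0:ℝ) ≤ 2), Real.sqrt_sq hr0]
    set Λ : ℝ := (1 + ε₀) ^ ((5 : ℝ) * (k - 1 : ℤ) / 2) with hΛ
    have hΛ0 : 0 ≤ Λ := (Real.rpow_pos_of_pos hq1 _).le
    have hs_le : s ≤ c := hs.2.trans hτc
    have hstep : Real.sqrt 2 / 2 * Λ * A * q (k - 1) ^ 2 * s ≤ c * ρ k / Real.sqrt 2 := by
      -- Λ A q² ≤ ρ and s ≤ c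
      have h1 : Λ * A * q (k - 1) ^ 2 * s ≤ ρ k * c := by
        have hρ0 : 0 ≤ ρ k := le_trans (by positivity) hrec
        calc Λ * A * q (k - 1) ^ 2 * s ≤ Λ * A * q (k - 1) ^ 2 * c :=
              mul_le_mul_of_nonneg_left hs_le (by positivity)
          _ ≤ ρ k * c := mul_le_mul_of_nonneg_right hrec (hs.1.trans hs_le)
      rw [le_div_iff₀ hs2]
      have e1 : Real.sqrt 2 / 2 * Λ * A * q (k - 1) ^ 2 * s * Real.sqrt 2 =
          (Real.sqrt 2 * Real.sqrt 2) / 2 * (Λ * A * q (k - 1) ^ 2 * s) := by ring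
      rw [e1, hsq2]
      linarith
    have hbound : Real.sqrt (∑ j ∈ Finset.range L, ∑ i, F i (k + j) s) ≤ q k / Real.sqrt 2 := by
      rw [hr_sqrt] at hsq
      have h2 : r k / Real.sqrt 2 + c * ρ k / Real.sqrt 2 ≤ q k / Real.sqrt 2 := by
        rw [← add_div]
        exact div_le_div_of_nonneg_right hrq hs2.le
      linarith
    have hnonneg : 0 ≤ ∑ j ∈ Finset.range L, ∑ i, F i (k + j) s :=
      Finset.sum_nonneg fun j _ => Finset.sum_nonneg fun i _ => h.nonneg_F i (k + j) s hs
    have hqk0 : 0 ≤ q k / Real.sqrt 2 := le_trans (Real.sqrt_nonneg _) hbound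
    -- square both sides
    have h4 : ∑ j ∈ Finset.range L, ∑ i, F i (k + j) s ≤ (q k / Real.sqrt 2) ^ 2 := by
      rw [← Real.sqrt_le_sqrt_iff (sq_nonneg _), Real.sqrt_sq hqk0]
      exact hbound
    calc ∑ j ∈ Finset.range L, ∑ i, F i (k + j) s ≤ (q k / Real.sqrt 2) ^ 2 := h4
      _ = q k ^ 2 / 2 := by
          rw [div_pow, Real.sq_sqrt (by norm_num : (0:ℝ) ≤ 2)]
  -- signs: c > 0, ρ_k ≥ 0 and q_k ≥ r_k ≥ 0 for k ≥ K
  have hc : 0 < c := lt_of_lt_of_le hτ hτc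
  have hq_nonneg : ∀ k : ℤ, K ≤ k → 0 ≤ q k := by
    intro k hk
    obtain ⟨hr0, hrq, hrec⟩ := hprof k hk
    have hρ0 : 0 ≤ ρ k := le_trans (by positivity) hrec
    nlinarith
  -- amplitude bound at level k from the tail-sum bound at level k
  have amp : ∀ k : ℤ, K ≤ k →
      (∀ L : ℕ, ∀ s ∈ Icc 0 τ, ∑ j ∈ Finset.range L, ∑ i, F i (k + j) s ≤ q k ^ 2 / 2) →
      ∀ u ∈ Icc 0 τ, ∀ i, |S i k u| ≤ q k := by
    intro k hk hsum u hu i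
    have h1 : F i k u ≤ ∑ j, F j k u :=
      Finset.single_le_sum (f := fun j => F j k u) (fun j _ => h.nonneg_F j k u hu) (Finset.mem_univ i)
    have h2 := hsum 1 u hu
    simp only [Finset.range_one, Finset.sum_singleton, Nat.cast_zero, add_zero] at h2
    have h3 : S i k u ^ 2 ≤ q k ^ 2 := by linarith [h.defect_lower i k u hu]
    exact abs_le_of_sq_le_sq' h3 (hq_nonneg k hk) |> fun h => abs_le.mpr ⟨h.1, h.2⟩
  -- induction on the number of levels above K
  have key : ∀ n : ℕ, ∀ L : ℕ, ∀ s ∈ Icc 0 τ,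
      ∑ j ∈ Finset.range L, ∑ i, F i (K + n + j) s ≤ q (K + n) ^ 2 / 2 := by
    intro n
    induction n with
    | zero =>
      intro L s hs
      have := level K le_rfl hqK hbase L s hs
      simpa using this
    | succ n ih =>
      intro L s hs
      have hk : K ≤ K + (n + 1 : ℕ) := by push_cast; linarith
      have hk' : K ≤ K + (n : ℕ) := by linarith
      have hprev : K + ((n + 1 : ℕ) : ℤ) - 1 = K + (n : ℕ) := by push_cast; ring
      have hamp : ∀ u ∈ Icc 0 τ, ∀ i, |S i (K + ((n + 1 : ℕ) : ℤ) - 1) u| ≤ q (K + ((n + 1 : ℕ) : ℤ) - 1) := by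
        rw [hprev]
        exact amp (K + n) hk' ih
      have hq' : 0 ≤ q (K + ((n + 1 : ℕ) : ℤ) - 1) := by
        rw [hprev]; exact hq_nonneg _ hk'
      exact level _ hk hq' hamp L s hs
  intro k hk L s hs
  obtain ⟨n, hn⟩ := Int.eq_ofNat_of_zero_le (show 0 ≤ k - K by linarith)
  have hk' : k = K + (n : ℤ) := by linarith
  rw [hk']
  exact key n L s hs

end BarrierSoundness

end Summit.NavierStokesRegularity.NavierStokesRegularity.Theorems

end
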